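import Summits.BirchSwinnertonDyer.BirchSwinnertonDyer.Theorems.SchneiderFreeAdditiveX3UpperGordCellOfPrintDvdOnly
import Summits.BirchSwinnertonDyer.BirchSwinnertonDyer.Theorems.SchneiderFreeAdditiveX3KYNonAnomalousTwistOfPrint
import Literature.NumberTheory.EllipticCurves.IsogenyQuadraticTwistProofs
import Literature.NumberTheory.EllipticCurves.IsogenyFrobeniusTraceProofs
import HarnessLib

/-!
# Route `SchneiderFreeAdditiveX3Upper` (K1 wing), crux r3 `GordTwoBranchCoIMCField`: the UPPER half of BSD_p PER PAIR on the
# (G-ord, `e = 2`) cell AT EVERY ODD `p` — in particular `p = 3` — for the pairs with a NON-ANOMALOUS twist, from PUBLISHED facts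
# ∪ {Keller–Yin [DIV.dvd]} ∪ {the pair's twist-unit datum}

Cell `bsd-schneider-ideate`, seat `bsd-schneider-door-c5` (prover, generation 25; assembly layer; `--supports` 19177; FYI wing 20365).
PARTITION: board row B6 ∩ X3 ∩ sst-twist, `r = 1` (7 101 pairs; (G-ord, `e = 2`) half 2 560, of which 2 411 at `p = 3`) of
`Rank1Residual.partition`; types-the-object-of nothing new; EXTENDS generation 23's per-pair UPPER half (`…UpperGordCellOfPrintDvdOnly` §3,
`p ≥ 5`: 149 (G-ord) census pairs) to the 686 pairs at `p = 3` whose good-ordinary twist `E^{(−3)}` is NON-ANOMALOUS (kit j319291);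
closes none of B6's cells (BSD NOT advanced). bears_on: K1-wing (20365 r3) + K1-door (19177 r3).

WHAT.  Generation 23's per-pair theorem needs `p ≥ 5` at exactly one place: the clause «`𝔛 = X_ac^∅(E_K)` is `Λ`-torsion with `μ = 0`»
at the presented curve, taken from CGLS 2022 Prop. 14 through the non-anomalous clause, which at `p ≥ 5` holds by inertia alone.  At
odd `p` that clause holds under the per-pair hypothesis `NAT(W, p)` («every good-ordinary `p*`-twist model `V` of `W` has `p ∤ a_p(V) − 1`»,
`…SemistableTwistLocalThree`, `…KYNonAnomalousTwistOfPrint` §2).  Two plumbing points: (i) the wing's glue runs the co-socket at a GOOD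
MEMBER `W₁` of the isogeny class of `W`, so `NAT` must be TRANSPORTED along `ℚ`-isogenies — §1: the twist models `V`, `V₁` are isogenous
(`IsIsogenous.quadraticTwist`, `(X^{(d)})^{(d)} ≅ X`) and isogenous curves have the same `a_p` at a good prime (Faltings; tree
`frobeniusTrace_eq_of_isIsogenous`); (ii) §3 is generation 23's `coChainMemberField_gordTwo_of_coIMCFieldAt_of_control` VERBATIM with the
isogeny `W ~ W₁` handed to the co-socket hypothesis.

* §1 `forall_twist_of_isIsogenous` (NAT is a `ℚ`-isogeny invariant on the cell); §2 `additiveIMCUpperBDPInputManinAtField_…_of_forall_twist`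
  (the field-local co-socket at odd `p`, `d_K ≠ −3`, under NAT: DvdOnly §2 with [INV.μ] from `KYNonAnomalousTwist` §2); §3
  `coChainMemberField_gordTwo_of_coIMCFieldAt_isogenous_of_control`; §4 **`missingUpperBoundAt_gordTwo_odd_of_printedFacts_of_twistUnitAt_of_forall_twist_…`**:
  for every globally minimal `W/ℚ` with `r_an = 1`, odd `p`, `ClassX3 W p`, `SubGordTwo W p`, `NAT(W, p)`, `Upper.TwistUnitFieldOffSliverAt W p`:
  `MissingUpperBoundAt W p` — ⟸ `PrintedFacts` ∧ Hsieh 2014 Thm. A ∧ LZZ 2018 ∧ CGLS 2022 Prop. 14 ∧ Castella–Hsieh signed existence (PUBLISHED)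
  ∧ [DIV.dvd] (ONE preprint sentence).

HONEST FRAMING: compositions of tree theorems, CONDITIONAL BY NAME on the displayed published facts and on Keller–Yin's divisibility sentence
`thm336_dvd_branch_OPEN` (preprint); the Castella–Hsieh / LZZ facts are consumed exactly as typed (their own standing hypotheses on `p`
are theirs); no definition, no named fact introduced, no `sorry`; nothing for the ANOMALOUS pairs; closes no item; BSD proved for no curve;
«closes rung: none».  References: CGLS, Invent. Math. 227 (2022) §1.2 Prop. 14 [CastellaGrossiLeeSkinner2022]; Keller–Yin arXiv:2410.23241
Thm. 3.3.6, Prop. 3.4.4 [KellerYin2024b]; Faltings 1983 §5 Kor. 2 [Faltings1983Endlichkeit]; Silverman *AEC* X.5 [SilvermanAEC2009];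
Jetchev–Skinner–Wan 2017 §7.4.1 [JetchevSkinnerWan2017]; generation 23's `…UpperGordCellOfPrintFiveLe` / `…DvdOnly`.
-/

set_option autoImplicit false
set_option linter.dupNamespace false -- the summit namespace `…BirchSwinnertonDyer.BirchSwinnertonDyer.Theorems` (Sub = Summit, D-0017) trips it

noncomputable section

open scoped Classical NumberField

open Field NumberField IsDedekindDomain WeierstrassCurve PowerSeries
  Literature.NumberTheory.EllipticCurves Literature.NumberTheory.EllipticCurves.GreenbergSelmer
  Literature.NumberTheory.GaloisRepresentations Literature.NumberTheory.GaloisCohomology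
  Literature.NumberTheory.EllipticCurves.ModularForms Literature.NumberTheory.EllipticCurves.Rank1Residual
  Literature.NumberTheory.EllipticCurves.Rank1Residual.Typed
  Literature.NumberTheory.EllipticCurves.IwasawaAlgebra
  Literature.NumberTheory.EllipticCurves.KellerYin2024 Literature.NumberTheory.EllipticCurves.CaiShuTian2014
  Summit.BirchSwinnertonDyer.Rank1Residual Summit.BirchSwinnertonDyer.Rank1Residual.Additive
  Summit.BirchSwinnertonDyer.Rank1Residual.X11b
  Summit.BirchSwinnertonDyer.Rank1Residual.X11b.AcSelmer Summit.BirchSwinnertonDyer.Rank1Residual.X11b.Halves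
  Summit.BirchSwinnertonDyer.Rank1Residual.X11b.CongruenceLimit
  Summit.BirchSwinnertonDyer.BirchSwinnertonDyer.Theorems
  Summit.BirchSwinnertonDyer.BirchSwinnertonDyer.Theorems.SchneiderFree
  Summit.BirchSwinnertonDyer.BirchSwinnertonDyer.Theorems.SchneiderFree.Upper
  Summit.BirchSwinnertonDyer.BirchSwinnertonDyer.Theorems.SchneiderFree.KYRead
  Summit.BirchSwinnertonDyer.BirchSwinnertonDyer.Theorems.SchneiderFreeAdditiveX3
  Summit.BirchSwinnertonDyer.BirchSwinnertonDyer.Theorems.SchneiderFreeAdditiveX3.LZZMatch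
  Summit.BirchSwinnertonDyer.BirchSwinnertonDyer.Theorems.SchneiderFreeAdditiveX3.ControlDischarged
  Summit.BirchSwinnertonDyer.BirchSwinnertonDyer.Theorems.SchneiderFreeAdditiveX3.KYBranchOnly
  Summit.BirchSwinnertonDyer.BirchSwinnertonDyer.Theorems.SchneiderFreeAdditiveX3.KYBranchHalves
  Summit.BirchSwinnertonDyer.BirchSwinnertonDyer.Theorems.SchneiderFreeAdditiveX3.KYMuZeroOfPrint
  Summit.BirchSwinnertonDyer.BirchSwinnertonDyer.Theorems.SchneiderFreeAdditiveX3.UpperOfPrint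
  Summit.BirchSwinnertonDyer.BirchSwinnertonDyer.Theorems.SchneiderFreeAdditiveX3.UpperOfPrintDvd
  Summit.BirchSwinnertonDyer.BirchSwinnertonDyer.Theorems.SchneiderFreeAdditiveX3.KYNonAnomalousTwist

open Literature.NumberTheory.EllipticCurves.CastellaGrossiLeeSkinner2022 (prop14_residualCharacterSelmer_finite)

open Summit.BirchSwinnertonDyer.BirchSwinnertonDyer.Theses.SchneiderFreeAdditiveX3Upper

namespace Summit.BirchSwinnertonDyer.BirchSwinnertonDyer.Theorems.SchneiderFreeAdditiveX3.UpperOfPrintNonAnomalousTwist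

/-! ### §1 `NAT(W, p)` is a `ℚ`-isogeny invariant on the (G-ord, `e = 2`) cell -/

/-- **The non-anomalous-twist clause passes along `ℚ`-isogenies.**  If `W ~ W₁` over `ℚ`, `W` lies on the cell `ClassX3 ∧ SubGordTwo` at the odd
prime `p`, and EVERY good-ordinary `p*`-twist model `V` of `W` has `p ∤ a_p(V) − 1`, then so has every good-ordinary `p*`-twist model `V₁` of
`W₁`: a model `V` of `W` exists (`ClassX3Gord.exists_goodOrd_pStar_twist_model`), `V^{(p*)} ≅ W ~ W₁ ≅ V₁^{(p*)}`, twisting once more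
`V ≅ (V^{(p*)})^{(p*)} ~ (V₁^{(p*)})^{(p*)} ≅ V₁` (`IsIsogenous.quadraticTwist`, `exists_quadraticTwist_quadraticTwist_eq_smul`), and isogenous
curves have the same trace of Frobenius at a prime of good reduction (`frobeniusTrace_eq_of_isIsogenous`).
[cite: Faltings1983Endlichkeit, §5 Korollar 2] [cite: SilvermanAEC2009, X.5 Cor. 5.4 and Cor. VII.7.2] -/
theorem forall_twist_of_isIsogenous {W W₁ : WeierstrassCurve ℚ} [W.IsElliptic] [W.IsGloballyMinimal] [W₁.IsElliptic] [W₁.IsGloballyMinimal]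
    {p : ℕ} [Fact p.Prime] (hp2 : p ≠ 2) (hX : ClassX3 W p) (hSG : Additive.SubGordTwo W p) (hiso : IsIsogenous W W₁)
    (htw : ∀ (V : WeierstrassCurve ℚ) [V.IsElliptic] [V.IsGloballyMinimal] (C : VariableChange ℚ),
      GoodOrd V p → C • V.quadraticTwist ((-1 : ℚ) ^ (p / 2) * p) = W → ¬ (p : ℤ) ∣ V.frobeniusTrace p - 1) :
    ∀ (V₁ : WeierstrassCurve ℚ) [V₁.IsElliptic] [V₁.IsGloballyMinimal] (C₁ : VariableChange ℚ),
      GoodOrd V₁ p → C₁ • V₁.quadraticTwist ((-1 : ℚ) ^ (p / 2) * p) = W₁ → ¬ (p : ℤ) ∣ V₁.frobeniusTrace p - 1 := by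
  intro V₁ _ _ C₁ hV₁ hC₁
  have hXG : ClassX3Gord W p := (classX3Gord_iff_subGord W p hp2 hX).mpr hSG.1
  obtain ⟨V, _, _, C, hV, hC⟩ := ClassX3Gord.exists_goodOrd_pStar_twist_model W p hp2 hXG hSG.2
  set d : ℚ := (-1 : ℚ) ^ (p / 2) * p with hd
  have hd0 : d ≠ 0 := pStar_ne_zero p
  -- `V^{(d)} ~ V₁^{(d)}`
  have h1 : IsIsogenous (V.quadraticTwist d) (V₁.quadraticTwist d) := by
    have hW : IsIsogenous (V.quadraticTwist d) W := by rw [← hC]; exact isIsogenous_smul _ C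
    have hW₁ : IsIsogenous W₁ (V₁.quadraticTwist d) := by
      have h := isIsogenous_smul W₁ C₁⁻¹
      rw [← hC₁, inv_smul_smul] at h
      rwa [← hC₁]
    exact (hW.trans' hiso).trans' hW₁
  -- `V ~ V₁`
  have h2 : IsIsogenous V V₁ := by
    obtain ⟨D, hD⟩ := exists_quadraticTwist_quadraticTwist_eq_smul V hd0
    obtain ⟨D₁, hD₁⟩ := exists_quadraticTwist_quadraticTwist_eq_smul V₁ hd0
    have h := h1.quadraticTwist hd0
    rw [hD, hD₁] at h
    have hV' : IsIsogenous V (D • V) := isIsogenous_smul V D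
    have hV₁' : IsIsogenous (D₁ • V₁) V₁ := by
      have h' := isIsogenous_smul (D₁ • V₁) D₁⁻¹
      rwa [inv_smul_smul] at h'
    exact (hV'.trans' h).trans' hV₁'
  rw [← frobeniusTrace_eq_of_isIsogenous h2 p hV.1 hV₁.1]
  exact htw V C hV hC

/-! ### §2 The field-local (G-ord, `e = 2`) co-socket at odd `p` under `NAT` -/

/-- **The field-local (G-ord, `e = 2`) co-socket `AdditiveIMCUpperBDPInputManinAtField W p K` at ODD `p` and `d_K ≠ −3`, under `NAT(W, p)`
⇐ Kolyvagin ∧ modularity ∧ Hsieh 2014 Thm. A ∧ LZZ 2018 ∧ Castella–Hsieh signed existence ∧ CGLS 2022 Prop. 14 (ALL PUBLISHED) ∧ [DIV.dvd]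
(Keller–Yin's divisibility sentence, PREPRINT).**  Generation 23's `UpperOfPrintDvd.additiveIMCUpperBDPInputManinAtField_of_hsieh_of_lzz_of_KY_dvd_of_prop14_of_castellaHsieh_signed`
VERBATIM with «`𝔛` torsion and `μ = 0`» at the presented curve from `KYNonAnomalousTwist.isTorsion_muInvariant_eq_zero_empty_of_prop14_of_subGordTwo_of_forall_twist`
(CGLS Prop. 14 + the Frobenius-of-the-twist clause) instead of the `p ≥ 5` inertia clause.  CONDITIONAL; nothing asserted about BSD.
[cite: CastellaGrossiLeeSkinner2022, §1.2 Prop. 14 (arXiv:2008.02571; Invent. Math. 227 (2022))]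
[cite: KellerYin2024b, Thm. 3.3.6 and Prop. 3.4.4, divisibility clause (arXiv:2410.23241 p. 19) (preprint; hypothesis)]
[cite: CastellaHsieh2018, §3.3, Def. 3.7 and Prop. 3.8] [cite: Hsieh2014, Thm. A p. 712 (Doc. Math. 19)]
[cite: LiuZhangZhang2018, Thm 1.5.1 and Thm 1.5.3 (Duke Math. J. 167 pp. 748–749)] [cite: AtkinLehner1970, Thm. 4] -/
theorem additiveIMCUpperBDPInputManinAtField_of_hsieh_of_lzz_of_KY_dvd_of_prop14_of_castellaHsieh_signed_of_forall_twist
    (hKo : ∀ (N : ℕ) [NeZero N] (W : WeierstrassCurve ℚ) (K : Type) [Field K] [NumberField K],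
      Literature.NumberTheory.EllipticCurves.kolyvagin N W K)
    (hPar : nonempty_modularParametrizationData)
    (hA : Hsieh2014.thmA_exists_isHsiehLFunction_unrPeriod_anyLevel)
    (hL : LiuZhangZhang2018.thm151_thm153_modularCurve_heegnerVector_additive)
    (hdvd : thm336_dvd_branch_OPEN) (h14 : prop14_residualCharacterSelmer_finite)
    (hCHσ : castellaHsieh2018_exists_isBranchBDPLFunction_signed)
    {W : WeierstrassCurve ℚ} [W.IsElliptic] [W.IsGloballyMinimal] {p : ℕ} [Fact p.Prime]
    (hp2 : p ≠ 2) (hX : ClassX3 W p) (hSG : Additive.SubGordTwo W p)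
    (htw : ∀ (V : WeierstrassCurve ℚ) [V.IsElliptic] [V.IsGloballyMinimal] (C : VariableChange ℚ),
      GoodOrd V p → C • V.quadraticTwist ((-1 : ℚ) ^ (p / 2) * p) = W → ¬ (p : ℤ) ∣ V.frobeniusTrace p - 1)
    (hlat : ∃ Φ : AddSubgroup (geomTorsion W (p : ℤ)), IsRationalLine W p Φ ∧ ¬ LineDecompositionTrivialAt W p Φ)
    (K : Type) [Field K] [NumberField K] (hdK : NumberField.discr K ≠ -3) :
    AdditiveIMCUpperBDPInputManinAtField W p K := by
  have hp : p.Prime := Fact.out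
  have hp2' : 2 < p := lt_of_le_of_ne hp.two_le (Ne.symm hp2)
  have hcase : W.HasGoodOrdinaryReductionOverQuadraticAt p :=
    hasGoodOrdinaryReductionOverQuadraticAt_of_subGordTwo hp2 W hX hSG
  obtain ⟨Φ₀, hΦ₀, -⟩ := id hlat
  have hred : Red W p := red_of_isRationalLine hΦ₀
  have hμT : ∀ (K : Type) [Field K] [NumberField K] (𝔭 : HeightOneSpectrum (𝓞 K)) (κ : ZpExtension K p)
      (γ : absoluteGaloisGroup K) [Fact (κ.IsTopGenerator γ)], IsImaginaryQuadratic K →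
      SatisfiesHeegnerHypothesis (W.conductorNorm ℤ) K → ((Ideal.span {(p : ℤ)}).primesOver (𝓞 K)).ncard = 2 →
      ((p : ℕ) : 𝓞 K) ∈ 𝔭.asIdeal → κ.IsAnticyclotomic →
      Module.IsTorsion (IwasawaAlgebra p) (Castella2018.AcSelmer.XAc (W.baseChange K) p κ 𝔭 ∅ γ) ∧
        muInvariant p (Castella2018.AcSelmer.XAc (W.baseChange K) p κ 𝔭 ∅ γ) = 0 :=
    fun K _ _ 𝔭 κ γ _ hK hHe hsplit h𝔭 hκ ↦
      KYNonAnomalousTwist.isTorsion_muInvariant_eq_zero_empty_of_prop14_of_subGordTwo_of_forall_twist h14 W K 𝔭 κ γ hp2' hX hSG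
        htw hK hHe hsplit h𝔭 hκ
  obtain ⟨W', hE', hmin', C₂, hW, hord, hΔ⟩ :=
    exists_goodOrd_partner_presentation_of_subGordTwo_odd hp2 W hX hSG
  subst hW
  haveI : NeZero (W'.conductorNorm ℤ) := ⟨(WeierstrassCurve.conductorNorm_pos_holds W').ne'⟩
  intro N _ Dt H ι P hr' hloc hN hK hodd hunit hHe hL1 hP hnt htf κ hκ γ _ 𝔭 h𝔭 he hf
  refine additiveIMCUpperBDPOnTreeLeAt_of_kolyvagin_of_hsieh_of_lzz_of_intCoDivConj hKo hA hL hp2 hX (Or.inr hSG) Dt H ι P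
    hr' hloc hN hK hodd hunit hHe hL1 hP hnt κ hκ γ 𝔭 h𝔭 he hf ?_
  intro 𝔮 h𝔮 hne he' hf' ι' hι' ΩK Ωp Q hΩK hΩp hQ
  obtain ⟨Dt'⟩ := hPar W'
  haveI : IsGalois ℚ K := Literature.FieldTheory.Galois.isGalois_of_finrank_eq_two hK.1
  have hpN' : ¬ p ∣ W'.conductorNorm ℤ := not_dvd_conductorNorm_of_hasGoodReductionAtPrime W' hord.1
  have hmodN : exists_isNewformOf := exists_isNewformOf_of_nonempty_modularParametrizationData hPar
  have hHe' : SatisfiesHeegnerHypothesis (W'.conductorNorm ℤ) K :=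
    SatisfiesHeegnerHypothesis.of_dvd (conductorNorm_partner_dvd_level hmodN hp2 W' hord.1 _ C₂ Dt) hHe
  -- torsion AND `μ(𝔛) = 0` at `v̄ = 𝔭` for the presented curve itself, FROM PRINT (CGLS Prop. 14 + the Frobenius-of-the-twist clause)
  have hsplit : ((Ideal.span {(p : ℤ)}).primesOver (𝓞 K)).ncard = 2 :=
    ncard_primesOver_eq_two_of_degreeOne hK.1 h𝔭 he hf
  obtain ⟨hT, hμX⟩ := hμT K 𝔭 κ γ hK (by rw [hN]; exact hHe) hsplit h𝔭 hκ
  exact span_le_xac_charIdeal_map_of_KY_dvd_of_isTorsion_of_muInvariant_eq_zero hCHσ hdvd hmodN hp2 W' hord.1 _ C₂ Dt Dt' hpN'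
    hK hHe hHe' hodd hdK hκ γ h𝔭 he hf h𝔮 hne hι' hN hcase hred hlat htf hT hμX hΩK hΩp hQ

/-! ### §3 The co-chain member at a field, with the isogeny handed to the co-socket -/

/-- **Co-chain member on the (G-ord, `e = 2`) cell at a field `K`, from a co-socket supplied for the curves of the cell ISOGENOUS TO `W`
only.**  Generation 23's `UpperOfPrint.coChainMemberField_gordTwo_of_coIMCFieldAt_of_control` VERBATIM, except that the hypothesis `hCo` also
receives `IsIsogenous W W₁` (the proof applies it at the good member `W₁ ~ W`), so that per-pair hypotheses on `W` which are isogeny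
invariants (here `NAT`, §1) can be fed to it.  CONDITIONAL on `hCtl`, `hCo`; nothing asserted about BSD.
[cite: KellerYin2024b, §3.3 ¶1 and Assumption 2.0.3 (arXiv:2410.23241 pp. 8, 14)] [cite: Mazur1978, Prop. 5.4] [cite: JetchevSkinnerWan2017, §7.4.1] -/
theorem coChainMemberField_gordTwo_of_coIMCFieldAt_isogenous_of_control
    (hKo : ∀ (N : ℕ) [NeZero N] (W : WeierstrassCurve ℚ) (K : Type) [Field K] [NumberField K],
      kolyvagin N W K)
    (hPar : nonempty_modularParametrizationData)
    (hCtl : ∀ (W : WeierstrassCurve ℚ) [W.IsElliptic] [W.IsGloballyMinimal] (p : ℕ) [Fact p.Prime],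
      W.analyticRank = 1 → p ≠ 2 → ClassX3 W p → Additive.SubSemistableTwist W p →
      AdditiveControlInputManinAt W p)
    (W : WeierstrassCurve ℚ) [W.IsElliptic] [W.IsGloballyMinimal] (p : ℕ) [Fact p.Prime]
    (hr : W.analyticRank = 1) (hp2 : p ≠ 2) (hX : ClassX3 W p) (hS : Additive.SubGordTwo W p)
    (K : Type) [Field K] [NumberField K] (hK : IsImaginaryQuadratic K)
    (hpd : ¬ (p : ℤ) ∣ NumberField.discr K)
    (hCo : ∀ (W₁ : WeierstrassCurve ℚ) [W₁.IsElliptic] [W₁.IsGloballyMinimal], IsIsogenous W W₁ →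
      ClassX3 W₁ p → Additive.SubGordTwo W₁ p →
      (∃ Φ : AddSubgroup (geomTorsion W₁ (p : ℤ)), IsRationalLine W₁ p Φ ∧ ¬ LineDecompositionTrivialAt W₁ p Φ) →
        AdditiveIMCUpperBDPInputManinAtField W₁ p K) :
    ∃ (W₁ : WeierstrassCurve ℚ) (_ : W₁.IsElliptic) (_ : W₁.IsGloballyMinimal),
      IsIsogenous W W₁ ∧ W₁.conductorNorm ℤ = W.conductorNorm ℤ ∧ Additive.N10.Locus W₁ p ∧
      (∀ Q : (W₁.baseChange K).toAffine.Point, p • Q = 0 → Q = 0) ∧ AdditiveCoStepLInputManinAtField W₁ p K := by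
  have hp : p.Prime := Fact.out
  obtain ⟨W₁, hE₁, hmin₁, φ, m, -, -, hN₁, -, hred₁, hlat₁, htf₁⟩ :=
    GoodMember.exists_goodMember_of_modularParametrization hPar hp2 W hX hS K hK.1 hpd
  have hiso₁ : IsIsogenous W₁ W := ⟨φ⟩
  have hiso₁' : IsIsogenous W W₁ := hiso₁.symm_of_isElliptic
  -- `W₁` lies on the cell, with `r_an(W₁) = 1`
  have hG : TypeG W p := (subGord_iff_typeG_of_addv W p hp2 hX.2).mp hS.1
  have hadd₁ : Addv W₁ p := Addv.of_isIsogenous_of_typeG hX.2 hG hiso₁'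
  have hSG₁ : SubGord W₁ p := (subGord_iff_of_isIsogenous hp2 hX.2 hiso₁').mp hS.1
  have he₁ : semistabilityIndex W₁ p = 2 :=
    (semistabilityIndex_eq_of_isIsogenous_of_typeG_of_addv hp2 hX.2 hG hiso₁').trans hS.2
  have hX₁ : ClassX3 W₁ p := ⟨hred₁, hadd₁⟩
  have hS₁ : Additive.SubGordTwo W₁ p := ⟨hSG₁, he₁⟩
  have hr₁ : W₁.analyticRank = 1 := by rw [analyticRank_eq_of_isIsogenous' hiso₁, hr]
  have hloc₁ : Additive.N10.Locus W₁ p :=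
    (Additive.N10.locus_iff_cells W₁ p).mpr
      ((Additive.N10.cellM_or_cellGordTwo_of_classX3_of_subSemistableTwist W₁ p hp2 hX₁ (Or.inr hS₁)).elim
        Or.inl (fun h ↦ Or.inr (Or.inl h)))
  -- co-STEP L♯ at `W₁` AT THE FIELD `K`: field-local co-socket at the good member + control + Kolyvagin
  have hco : AdditiveCoStepLInputManinAtField W₁ p K :=
    additiveCoStepLInputManinAtField_of_kolyvagin_of_control_of_imcUpperField (fun N _ K _ _ ↦ hKo N W₁ K)
      (hCtl W₁ p hr₁ hp2 hX₁ (Or.inr hS₁)) (hCo W₁ hiso₁' hX₁ hS₁ hlat₁)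
  exact ⟨W₁, hE₁, hmin₁, hiso₁', hN₁, hloc₁, htf₁, hco⟩

/-! ### §4 Per pair: the UPPER half on (G-ord, `e = 2`) at every odd `p` from PUBLISHED facts ∪ {[DIV.dvd]} ∪ {TU, NAT} -/

/-- **UPPER half per pair on the (G-ord, `e = 2`) cell at every ODD `p` — in particular `p = 3` — ⇐ `PrintedFacts` ∧ Hsieh 2014 Thm. A ∧
Liu–Zhang–Zhang 2018 ∧ CGLS 2022 Prop. 14 ∧ Castella–Hsieh signed existence (ALL PUBLISHED) ∧ [DIV.dvd] (Keller–Yin 2410.23241 Thm 3.3.6 ∘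
Prop 3.4.4, the DIVISIBILITY sentence — the ONE unrefereed input) ∧ the pair's twist-unit datum ∧ the pair's non-anomalous-twist clause
`NAT(W, p)`.**  For every globally minimal `W/ℚ` with `r_an = 1`, `p` odd, `ClassX3 W p`, `SubGordTwo W p`, `NAT(W, p)`,
`Upper.TwistUnitFieldOffSliverAt W p`: `MissingUpperBoundAt W p` (`ord_p #Ш(E) ≤ ord_p #Ш(E)_an`).  Generation 23's DvdOnly §3 VERBATIM with
§3's isogenous co-chain member, §1's transport of NAT, §2's co-socket, and the CLOSED control corner.  At `p = 3` this is the upper half for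
the 686 non-anomalous (G-ord) pairs of the census whose TU datum is certified (kit j311179/j312035, generation 21: all 7 101 pairs).
CONDITIONAL; closes no item; BSD not advanced.
[cite: CastellaGrossiLeeSkinner2022, §1.2 Prop. 14 (arXiv:2008.02571; Invent. Math. 227 (2022))]
[cite: KellerYin2024b, Thm. 3.3.6 and Prop. 3.4.4, divisibility clause (arXiv:2410.23241 p. 19) (preprint; hypothesis)]
[cite: JetchevSkinnerWan2017, §7.4.1 (arXiv:1512.06894 p. 30)] [cite: CastellaHsieh2018, §3.3, Def. 3.7 and Prop. 3.8] [cite: Miller2011LMS, Def. 1.1] -/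
theorem missingUpperBoundAt_gordTwo_odd_of_printedFacts_of_twistUnitAt_of_forall_twist_of_hsieh_of_lzz_of_KY_dvd_of_prop14_of_castellaHsieh_signed
    (hF : PrintedFacts) (hA : Hsieh2014.thmA_exists_isHsiehLFunction_unrPeriod_anyLevel)
    (hL : LiuZhangZhang2018.thm151_thm153_modularCurve_heegnerVector_additive)
    (hdvd : thm336_dvd_branch_OPEN) (h14 : prop14_residualCharacterSelmer_finite)
    (hCHσ : castellaHsieh2018_exists_isBranchBDPLFunction_signed) :
    ∀ (W : WeierstrassCurve ℚ) [W.IsElliptic] [W.IsGloballyMinimal] (p : ℕ) [Fact p.Prime],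
      p ≠ 2 → W.analyticRank = 1 → ClassX3 W p → Additive.SubGordTwo W p →
      (∀ (V : WeierstrassCurve ℚ) [V.IsElliptic] [V.IsGloballyMinimal] (C : VariableChange ℚ),
        GoodOrd V p → C • V.quadraticTwist ((-1 : ℚ) ^ (p / 2) * p) = W → ¬ (p : ℤ) ∣ V.frobeniusTrace p - 1) →
      Upper.TwistUnitFieldOffSliverAt W p → MissingUpperBoundAt W p := by
  obtain ⟨hGZ, hKo, hGZK, hmod, hPar, hCas, hGZ73, -, -, hHP, -, -, -⟩ := hF
  have hCtl := anticycControlAdditiveKF_proof controlFacts_proof.1 controlFacts_proof.2.1 controlFacts_proof.2.2.1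
    controlFacts_proof.2.2.2 hKo
  intro W _ _ p _ hp2 hr hX hG htw hTU
  have hpN : p ∣ W.conductorNorm ℤ := (W.dvd_conductorNorm_iff_not_hasGoodReductionAtPrime p).mpr hX.2.1
  exact Upper.missingUpperBoundAt_of_goodMemberCoStepLField_of_twistUnitFieldOffSliver hGZ hKo hGZK hmod hGZ73 hCas hHP W p hr hp2
    hpN (fun K _ _ hK _ hpd hdK ↦ coChainMemberField_gordTwo_of_coIMCFieldAt_isogenous_of_control hKo hPar hCtl W p hr hp2 hX hG K hK hpd
      fun W₁ _ _ hiso₁ hX₁ hS₁ hlat₁ ↦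
        additiveIMCUpperBDPInputManinAtField_of_hsieh_of_lzz_of_KY_dvd_of_prop14_of_castellaHsieh_signed_of_forall_twist hKo hPar hA hL
          hdvd h14 hCHσ hp2 hX₁ hS₁ (forall_twist_of_isIsogenous hp2 hX hG hiso₁ htw) hlat₁ K hdK) hTU

end Summit.BirchSwinnertonDyer.BirchSwinnertonDyer.Theorems.SchneiderFreeAdditiveX3.UpperOfPrintNonAnomalousTwist

end
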